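import Literature.Computability.Cryptography.ShorFactPost
import Literature.Computability.Cryptography.ShorClassicalOracle
import Literature.Computability.Cryptography.ShorOrderFindingQuantum
import HarnessLib

/-!
# Shor's theorem `FACT ∈ BQP`: the assembly from the named infrastructure facts

Family `PQC` (trunk `CryptoQuantFine`); closes the chain of companions of
`Literature/Computability/Cryptography/Shor.lean` for the named fact `Literature.Computability.Cryptography.FACT_mem_BQP`
(Shor 1997, §5, decision form). The mathematics of Shor's theorem is proved in the tree:

* the randomised classical reduction from factoring to order finding and its recursion to a
  complete factorisation, probability `≥ 3/4` (`ShorFactoring`, `ShorAssembly`), written as an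
  oracle computation relative to the order-bit language (`ShorClassicalOracle`);
* the quantum order-finding experiment (Kitaev's eigenvalue measurement over the exact
  Clifford+T gate set), its outcome law and its analysis, success `≥ 77/96`
  (`KitaevPhaseEstimationSums`, `KitaevPhaseEstimationCircuit`, `KitaevPhaseReconstruction`,
  `ShorOrderFindingAnalysis`, `ShorOrderFindingQuantum`);
* the decision version from the search version (`ShorProofs`, `ShorFactPost`: a 63-instruction
  stack program comparing the least prime factor with the bound).

What remains are seven named *infrastructure* facts about the tree's machine and circuit
models, none specific to factoring mathematics: classical pre/post-processing and `BQP`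
subroutines inside bounded-error quantum search (`isQSolvable_classicalWrap`,
`isQSolvable_of_mem_BQP_oracle`, Bennett–Bernstein–Brassard–Vazirani 1997, Thm. 4.14), coins
and reversible simulation of polynomial-time oracle machines
(`kernelProb_ge_uniformProb_of_mem_FPRel`, Bernstein–Vazirani 1997, Thm. 8.3), the uniform
clean modular-exponentiation block of Kitaev's family (`Kitaev1995_orderFindingFamily`,
Shor 1997, §3), and three programming facts (`ordPost_mem_FP`, `orderFindingPost_mem_FP`,
`Shor1997.shorComp_isPolyTime`). This file records the two implications.

## References

* P. W. Shor, *Polynomial-time algorithms for prime factorization and discrete logarithms on a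
  quantum computer*, SIAM J. Comput. 26 (1997) 1484–1509, §5.
* A. Yu. Kitaev, *Quantum measurements and the Abelian Stabilizer Problem*,
  arXiv:quant-ph/9511026 (1995), §3–§4.
-/

noncomputable section

namespace Literature.Computability.Cryptography

open _root_.Computability Complexity

/-- **Shor's theorem, FBQP form, from the infrastructure facts**: the prime factorisation is
computable in bounded-error quantum polynomial time (`isQSolvable_factoring`), by
`isQSolvable_factoring_of` (`ShorAssembly`) fed with `shorClassical_mem_FPRel_of`
(`ShorClassicalOracle`) and the quantum half `Shor1997_orderFinding_isQSolvable_of`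
(`ShorOrderFindingQuantum`). [cite: Shor1997, §5 (Theorem on factoring)] -/
theorem isQSolvable_factoring_of_facts (hwrap : isQSolvable_classicalWrap)
    (hfam : Kitaev1995_orderFindingFamily) (hpostOF : orderFindingPost_mem_FP)
    (hpost : ordPost_mem_FP) (hsub : isQSolvable_of_mem_BQP_oracle)
    (hsim : kernelProb_ge_uniformProb_of_mem_FPRel) (hcomp : Shor1997.shorComp_isPolyTime) :
    isQSolvable_factoring :=
  isQSolvable_factoring_of hwrap hpost hsub hsim (shorClassical_mem_FPRel_of hcomp)
    (Shor1997_orderFinding_isQSolvable_of hwrap hfam hpostOF)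

/-- **Shor's theorem `FACT ∈ BQP` from the infrastructure facts** (`FACT_mem_BQP_of_wrap`,
`ShorFactPost`, on top of `isQSolvable_factoring_of_facts`). [cite: Shor1997, §5] -/
theorem FACT_mem_BQP_of_facts (hwrap : isQSolvable_classicalWrap)
    (hfam : Kitaev1995_orderFindingFamily) (hpostOF : orderFindingPost_mem_FP)
    (hpost : ordPost_mem_FP) (hsub : isQSolvable_of_mem_BQP_oracle)
    (hsim : kernelProb_ge_uniformProb_of_mem_FPRel) (hcomp : Shor1997.shorComp_isPolyTime) :
    FACT_mem_BQP :=
  FACT_mem_BQP_of_wrap hwrap (isQSolvable_factoring_of_facts hwrap hfam hpostOF hpost hsub hsim hcomp)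

end Literature.Computability.Cryptography

end
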